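import Literature.Computability.QuantumComplexity.MSubspaceSignReadoutRelaxedRuns
import Literature.Computability.QuantumComplexity.SignedCubicForrelation
import Summits.QuantumAdvantage.QuantumAdvantage.Theses.CubicForrelation
import Literature.Computability.Complexity.CountingHierarchyInter
import Summits.QuantumAdvantage.QuantumAdvantage.Theorems.CubicForrelationSignedCubicForrelationInPrBPPStubDualValue
import Summits.QuantumAdvantage.QuantumAdvantage.Theorems.CubicForrelationSignedCubicForrelationInPrBPPStubCertify
import Summits.QuantumAdvantage.QuantumAdvantage.Theorems.CubicForrelationSignedCubicForrelationInPrBPPStubPassThrough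

/-!
# Crux `CubicForrelation.SignedCubicForrelationInPrBPP` (stmt-QuantumAdvantage-13933)

Stub `stub_safeMMR` of the line `polar-radical-seeds` (registered skeleton r2,
`Cruxes/SignedCubicForrelationInPrBPP/Lines/polar_radical_seeds.lean`): the SAFE PARTIAL DECIDER of the
RELAXED Maiorana–McFarland side of signed cubic 2-fold Forrelation (`signedCubicForrelationProblem 2`;
Aaronson–Ambainis 2018, §1.1.1 and §6; promise-BPP in the coin model of Goldreich 2006, Def. 1.2).

Given (i) a polynomial-time finder `find` that, on every promise instance whose second function is affine on
the cosets of a `⊕`-closed `V ∋ 0` of M-defect `≤ c log₂(n+2)`, outputs with probability `≥ 2/3` rows of rank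
defect `≤ c' log₂(n+2)` spanning a certified coset-affine subspace, (ii) the dual-value identity for coset-affine
subspaces and (iii) the finite affine-ness certificate for cubics, there is `dec ∈ FP` and a coin polynomial
such that on EVERY promise instance the wrong verdict has probability `≤ 1/10`, and on promise instances one of
whose two functions has M-defect `≤ c log₂(n+2)` the right verdict has probability `≥ 9/10`.

The machine and its analysis are the Literature development `MSubspaceSignReadout{Machine, CodeFP, Sampler,
Relaxed, RelaxedRounds, RelaxedRuns}.lean` (`MMReadout.outR`: six finder runs on the instance and its
circuit-swap, the relaxed certificate `certOKR`, `200 (n+2)^{c'}` rounds of the dual-pair sampler, majority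
vote). This file only assembles: `dec` is the `FP` witness `MMReadout.exists_fp_outR`, the coin polynomial is
`MMReadout.coinPolyR c' pF`; the two error bounds on the promise are the SAFE LAW `MMReadout.cnt_outR_wrong_le`
(`≤ 1/72`), the two completeness bounds are the COMPLETE LAW `MMReadout.le_cnt_outR_right` (`≥ 9/10`) fed by
`MMReadout.finder_certifies_side` (the finder certifies the instance or its swap) and
`MMReadout.guard_of_half_lt_abs` (the idle-wire guard holds when `|Φ| > 1/2`).

Second part (appended): the LANDED REDUCTION of the crux to its open stubs. With `stub_safeMMR` (above),
`stub_dualValue`, `stub_certify`, `stub_passThrough` in the tree, the composition `SignedCubicForrelationInPrBPP_of`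
of the registered skeleton becomes a sorry-free implication: `SignedCubicForrelationInPrBPP_of_finderR_of_residueR`
(crux ⇐ `stub_finderR` ∧ `stub_residueR`), `residueR_of_structure` (`stub_structure` empties the residue),
`SignedCubicForrelationInPrBPP_of_finderR_of_structure`, and conversely `residueR_of_SignedCubicForrelationInPrBPP`
(the residue is a sub-promise of the crux, so `stub_residueR` is never falser than it). The open stubs
`stub_finderR`, `stub_residueR`, `stub_structure` appear only as HYPOTHESES, verbatim as registered
(skeleton sha `e0be2adf79ca`).
-/

noncomputable section

set_option linter.dupNamespace false -- D-0017: single-problem summit ⇒ `QuantumAdvantage.QuantumAdvantage` by design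

namespace Summit.QuantumAdvantage.QuantumAdvantage.Theorems.SignedCubicForrelationInPrBPP

open Finset
open Literature.Computability.Complexity Literature.Computability.QuantumComplexity
open Literature.Computability.QuantumComplexity.MMReadout
open Literature.Computability.QuantumComplexity.BuzetChailloux (bxor zeroVec)
open Summit.QuantumAdvantage.QuantumAdvantage.Theses.CubicForrelation

/-- `72 · cnt ≤ 2^m` gives probability `≤ 1/10`. -/
private theorem safeMMR_prob_le_tenth {m : ℕ} {E : Set (List Bool)} (h : 72 * (cnt m E : ℝ) ≤ 2 ^ m) :
    uniformProb m E ≤ 1 / 10 := by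
  rw [uniformProb_eq_cnt_div, div_le_iff₀ (by positivity)]
  linarith [show (0 : ℝ) ≤ cnt m E from Nat.cast_nonneg _]

/-- `9 · 2^m ≤ 10 · cnt` gives probability `≥ 9/10`. -/
private theorem safeMMR_le_prob {m : ℕ} {E : Set (List Bool)} (h : 9 * (2 : ℝ) ^ m ≤ 10 * cnt m E) :
    (9 / 10 : ℝ) ≤ uniformProb m E := by
  rw [uniformProb_eq_cnt_div, le_div_iff₀ (by positivity)]
  linarith

/-- **Stub `stub_safeMMR`** (registered signature verbatim): the safe partial decider of the relaxed
Maiorana–McFarland side of `signedCubicForrelationProblem 2`. -/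
theorem stub_safeMMR : ∀ c c' : ℕ,
    (∃ find ∈ FP, ∃ p : Polynomial ℕ, ∀ (I : KForrelationInstance) (hk : I.k = 2),
      Even I.n → I.IsOverB2 → (∀ i, IsDegLeFun 3 (I.C i).eval) → (3 / 5 : ℝ) ≤ |I.value| →
      (∃ V : Finset (Fin I.n → Bool), zeroVec ∈ V ∧ (∀ x ∈ V, ∀ y ∈ V, bxor x y ∈ V) ∧
        2 ^ I.n ≤ V.card ^ 2 * (I.n + 2) ^ (2 * c) ∧
        ∀ u ∈ V, ∀ v ∈ V, ∀ y, ((I.C (Fin.cast hk.symm 1)).eval y ^^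
          (I.C (Fin.cast hk.symm 1)).eval (bxor y u) ^^ (I.C (Fin.cast hk.symm 1)).eval (bxor y v) ^^
          (I.C (Fin.cast hk.symm 1)).eval (bxor y (bxor u v))) = false) →
      (2 / 3 : ℝ) ≤ uniformProb (p.eval I.encode.length)
        {y | ∃ L : List (List Bool), find (boolPair I.encode y) = encList L ∧
          I.n ≤ 2 * Module.finrank (ZMod 2) ↥(F2Elim.rowSpan I.n L) + c' * Nat.log 2 (I.n + 2) ∧
          ∀ u v : Fin I.n → Bool, (fun i => if u i then (1 : ZMod 2) else 0) ∈ F2Elim.rowSpan I.n L →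
            (fun i => if v i then (1 : ZMod 2) else 0) ∈ F2Elim.rowSpan I.n L →
          ∀ y, ((I.C (Fin.cast hk.symm 1)).eval y ^^
            (I.C (Fin.cast hk.symm 1)).eval (bxor y u) ^^ (I.C (Fin.cast hk.symm 1)).eval (bxor y v) ^^
            (I.C (Fin.cast hk.symm 1)).eval (bxor y (bxor u v))) = false}) →
    (∀ (n : ℕ) (f g : (Fin n → Bool) → Bool) (V : Finset (Fin n → Bool)),
      zeroVec ∈ V → (∀ x ∈ V, ∀ y ∈ V, bxor x y ∈ V) →
      (∀ u ∈ V, ∀ v ∈ V, ∀ y, (g y ^^ g (bxor y u) ^^ g (bxor y v) ^^ g (bxor y (bxor u v))) = false) →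
      (∑ z : Fin n → Bool,
          ∑ x ∈ univ.filter (fun x => ∀ v ∈ V, twist x v = signOf (g (bxor z v)) * signOf (g z)),
            signOf (f x) * signOf (g z) * twist x z =
        Real.sqrt (2 ^ (3 * n)) * forrelation f g) ∧
      (∀ z : Fin n → Bool,
        ((univ.filter (fun x => ∀ v ∈ V, twist x v = signOf (g (bxor z v)) * signOf (g z))).card : ℝ) *
          V.card = (2 : ℝ) ^ n)) →
    (∀ (n : ℕ) (g : (Fin n → Bool) → Bool), IsDegLeFun 3 g →
      ∀ L : List (List Bool),
      (∀ r ∈ L, ∀ s ∈ L, ∀ y : Fin n → Bool, (y = zeroVec ∨ ∃ i : Fin n, y = fun j => decide (j = i)) →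
        (g y ^^ g (bxor y (fun i => r.getD i false)) ^^ g (bxor y (fun i => s.getD i false)) ^^
          g (bxor y (bxor (fun i => r.getD i false) (fun i => s.getD i false)))) = false) →
      ∀ u v : Fin n → Bool, (fun i => if u i then (1 : ZMod 2) else 0) ∈ F2Elim.rowSpan n L →
        (fun i => if v i then (1 : ZMod 2) else 0) ∈ F2Elim.rowSpan n L →
      ∀ y, (g y ^^ g (bxor y u) ^^ g (bxor y v) ^^ g (bxor y (bxor u v))) = false) →
    ∃ dec ∈ FP, ∃ p : Polynomial ℕ,
      (∀ x ∈ (signedCubicForrelationProblem 2).yes,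
        uniformProb (p.eval x.length) {y | dec (boolPair x y) = [false]} ≤ 1 / 10) ∧
      (∀ x ∈ (signedCubicForrelationProblem 2).no,
        uniformProb (p.eval x.length) {y | dec (boolPair x y) = [true]} ≤ 1 / 10) ∧
      (∀ x ∈ KForrelationInstance.encode ''
          {I | I.IsYes ∧ (∃ i, ∃ V : Finset (Fin I.n → Bool), zeroVec ∈ V ∧
            (∀ x ∈ V, ∀ y ∈ V, bxor x y ∈ V) ∧ 2 ^ I.n ≤ V.card ^ 2 * (I.n + 2) ^ (2 * c) ∧
            ∀ u ∈ V, ∀ v ∈ V, ∀ y, ((I.C i).eval y ^^ (I.C i).eval (bxor y u) ^^ (I.C i).eval (bxor y v) ^^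
              (I.C i).eval (bxor y (bxor u v))) = false) ∧
            I.k = 2 ∧ Even I.n ∧ ∀ i, IsDegLeFun 3 (I.C i).eval},
        (9 / 10 : ℝ) ≤ uniformProb (p.eval x.length) {y | dec (boolPair x y) = [true]}) ∧
      (∀ x ∈ KForrelationInstance.encode ''
          {I | (I.IsOverB2 ∧ I.value ≤ -(3 / 5 : ℝ)) ∧ (∃ i, ∃ V : Finset (Fin I.n → Bool), zeroVec ∈ V ∧
            (∀ x ∈ V, ∀ y ∈ V, bxor x y ∈ V) ∧ 2 ^ I.n ≤ V.card ^ 2 * (I.n + 2) ^ (2 * c) ∧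
            ∀ u ∈ V, ∀ v ∈ V, ∀ y, ((I.C i).eval y ^^ (I.C i).eval (bxor y u) ^^ (I.C i).eval (bxor y v) ^^
              (I.C i).eval (bxor y (bxor u v))) = false) ∧
            I.k = 2 ∧ Even I.n ∧ ∀ i, IsDegLeFun 3 (I.C i).eval},
        (9 / 10 : ℝ) ≤ uniformProb (p.eval x.length) {y | dec (boolPair x y) = [false]}) := by
  rintro c c' ⟨find, hfind, pF, hF⟩ hdual hcert
  obtain ⟨dec, hdec, hdecEq⟩ := exists_fp_outR c' hfind pF
  -- the instance-level forms of the two identities handed to the laws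
  have hdualI : ∀ (I : KForrelationInstance) (f g : (Fin I.n → Bool) → Bool) (V : Finset (Fin I.n → Bool)),
      zeroVec ∈ V → (∀ x ∈ V, ∀ y ∈ V, bxor x y ∈ V) →
      (∀ u ∈ V, ∀ v ∈ V, ∀ y, (g y ^^ g (bxor y u) ^^ g (bxor y v) ^^ g (bxor y (bxor u v))) = false) →
      ∑ z : Fin I.n → Bool, ∑ x ∈ univ.filter (fun x => ∀ v ∈ V, twist x v = signOf (g (bxor z v)) * signOf (g z)),
          signOf (f x) * signOf (g z) * twist x z = Real.sqrt (2 ^ (3 * I.n)) * forrelation f g :=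
    fun I f g V h0 hadd hM => (hdual I.n f g V h0 hadd hM).1
  -- the event of a verdict is the event of the machine's output
  have hev : ∀ (I : KForrelationInstance) (w : List Bool),
      {y : List Bool | dec (boolPair I.encode y) = w} =
        {y | outR c' find pF (ForrCode.instOf I) I.encode.length y = w} := by
    intro I w; ext y; simp only [Set.mem_setOf_eq]; rw [hdecEq I y]
  refine ⟨dec, hdec, coinPolyR c' pF, ?_, ?_, ?_, ?_⟩
  · -- SAFE on the yes-side: `[false] = [Φ < 0]` is the wrong verdict
    rintro x ⟨I, ⟨⟨hB2, hval⟩, hk, hn, hdeg⟩, rfl⟩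
    have hΦ : (3 / 5 : ℝ) ≤ |I.value| := hval.trans (le_abs_self _)
    have hw : [false] = [decide (I.value < 0)] := by rw [decide_eq_false (not_lt.2 (by linarith))]
    rw [hev, hw]
    exact safeMMR_prob_le_tenth (cnt_outR_wrong_le c' find pF I hk (hdualI I) (hcert I.n) hdeg hΦ)
  · -- SAFE on the no-side: `[true] = [Φ < 0]` is the wrong verdict
    rintro x ⟨I, ⟨⟨hB2, hval⟩, hk, hn, hdeg⟩, rfl⟩
    have hΦ : (3 / 5 : ℝ) ≤ |I.value| := by rw [abs_of_neg (by linarith)]; linarith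
    have hw : [true] = [decide (I.value < 0)] := by rw [decide_eq_true (by linarith)]
    rw [hev, hw]
    exact safeMMR_prob_le_tenth (cnt_outR_wrong_le c' find pF I hk (hdualI I) (hcert I.n) hdeg hΦ)
  · -- COMPLETE on the yes-side with a log-defect M-subspace: `[true] = [0 < Φ]` is the right verdict
    rintro x ⟨I, ⟨⟨hB2, hval⟩, hM, hk, hn, hdeg⟩, rfl⟩
    have hΦ : (3 / 5 : ℝ) ≤ |I.value| := hval.trans (le_abs_self _)
    have hw : [true] = [decide (0 < I.value)] := by rw [decide_eq_true (by linarith)]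
    rw [hev, hw]
    refine safeMMR_le_prob (le_cnt_outR_right c' find pF I hk (hdualI I) (hcert I.n) hdeg hΦ
      (guard_of_half_lt_abs I hk (by linarith)) ?_)
    exact finder_certifies_side c c' find pF hF I hk hn hB2 hdeg hΦ hM
  · -- COMPLETE on the no-side with a log-defect M-subspace: `[false] = [0 < Φ]` is the right verdict
    rintro x ⟨I, ⟨⟨hB2, hval⟩, hM, hk, hn, hdeg⟩, rfl⟩
    have hΦ : (3 / 5 : ℝ) ≤ |I.value| := by rw [abs_of_neg (by linarith)]; linarith
    have hw : [false] = [decide (0 < I.value)] := by rw [decide_eq_false (not_lt.2 (by linarith))]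
    rw [hev, hw]
    refine safeMMR_le_prob (le_cnt_outR_right c' find pF I hk (hdualI I) (hcert I.n) hdeg hΦ
      (guard_of_half_lt_abs I hk (by linarith)) ?_)
    exact finder_certifies_side c c' find pF hF I hk hn hB2 hdeg hΦ hM

/-! ## The landed reduction of the crux to its open stubs -/

/-- **The crux from its two open stubs.** `stub_finderR` (relaxed M-subspace recovery `∈ FP` with success
probability `≥ 2/3`) and `stub_residueR` (the both-sided-large-defect residue is in `PromiseBPP'`) imply
`SignedCubicForrelationInPrBPP`: the finder for the residue's constant `c` feeds the landed safe partial decider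
`stub_safeMMR` (with `stub_dualValue`, `stub_certify`), which is correct with probability `≥ 9/10` on every
promise instance outside the residue and wrong with probability `≤ 1/10` everywhere; `stub_passThrough` glues it
with the residue's decider. -/
theorem SignedCubicForrelationInPrBPP_of_finderR_of_residueR
    (hF : ∀ c : ℕ, ∃ c' : ℕ, ∃ find ∈ FP, ∃ p : Polynomial ℕ, ∀ (I : KForrelationInstance) (hk : I.k = 2),
      Even I.n → I.IsOverB2 → (∀ i, IsDegLeFun 3 (I.C i).eval) → (3 / 5 : ℝ) ≤ |I.value| →
      (∃ V : Finset (Fin I.n → Bool), zeroVec ∈ V ∧ (∀ x ∈ V, ∀ y ∈ V, bxor x y ∈ V) ∧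
        2 ^ I.n ≤ V.card ^ 2 * (I.n + 2) ^ (2 * c) ∧
        ∀ u ∈ V, ∀ v ∈ V, ∀ y, ((I.C (Fin.cast hk.symm 1)).eval y ^^
          (I.C (Fin.cast hk.symm 1)).eval (bxor y u) ^^ (I.C (Fin.cast hk.symm 1)).eval (bxor y v) ^^
          (I.C (Fin.cast hk.symm 1)).eval (bxor y (bxor u v))) = false) →
      (2 / 3 : ℝ) ≤ uniformProb (p.eval I.encode.length)
        {y | ∃ L : List (List Bool), find (boolPair I.encode y) = encList L ∧
          I.n ≤ 2 * Module.finrank (ZMod 2) ↥(F2Elim.rowSpan I.n L) + c' * Nat.log 2 (I.n + 2) ∧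
          ∀ u v : Fin I.n → Bool, (fun i => if u i then (1 : ZMod 2) else 0) ∈ F2Elim.rowSpan I.n L →
            (fun i => if v i then (1 : ZMod 2) else 0) ∈ F2Elim.rowSpan I.n L →
          ∀ y, ((I.C (Fin.cast hk.symm 1)).eval y ^^
            (I.C (Fin.cast hk.symm 1)).eval (bxor y u) ^^ (I.C (Fin.cast hk.symm 1)).eval (bxor y v) ^^
            (I.C (Fin.cast hk.symm 1)).eval (bxor y (bxor u v))) = false})
    (hR : ∃ c : ℕ,
    (⟨KForrelationInstance.encode ''
        {I | I.IsYes ∧ ¬ (∃ i, ∃ V : Finset (Fin I.n → Bool), zeroVec ∈ V ∧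
            (∀ x ∈ V, ∀ y ∈ V, bxor x y ∈ V) ∧ 2 ^ I.n ≤ V.card ^ 2 * (I.n + 2) ^ (2 * c) ∧
            ∀ u ∈ V, ∀ v ∈ V, ∀ y, ((I.C i).eval y ^^ (I.C i).eval (bxor y u) ^^ (I.C i).eval (bxor y v) ^^
              (I.C i).eval (bxor y (bxor u v))) = false) ∧
          I.k = 2 ∧ Even I.n ∧ ∀ i, IsDegLeFun 3 (I.C i).eval},
      KForrelationInstance.encode ''
        {I | (I.IsOverB2 ∧ I.value ≤ -(3 / 5 : ℝ)) ∧ ¬ (∃ i, ∃ V : Finset (Fin I.n → Bool), zeroVec ∈ V ∧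
            (∀ x ∈ V, ∀ y ∈ V, bxor x y ∈ V) ∧ 2 ^ I.n ≤ V.card ^ 2 * (I.n + 2) ^ (2 * c) ∧
            ∀ u ∈ V, ∀ v ∈ V, ∀ y, ((I.C i).eval y ^^ (I.C i).eval (bxor y u) ^^ (I.C i).eval (bxor y v) ^^
              (I.C i).eval (bxor y (bxor u v))) = false) ∧
          I.k = 2 ∧ Even I.n ∧ ∀ i, IsDegLeFun 3 (I.C i).eval}⟩ : PromiseProblem) ∈ PromiseBPP') :
    SignedCubicForrelationInPrBPP := by
  show signedCubicForrelationProblem 2 ∈ PromiseBPP'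
  obtain ⟨c, hRc⟩ := hR
  obtain ⟨c', hFc⟩ := hF c
  have hS := stub_safeMMR c c' hFc stub_dualValue stub_certify
  refine stub_passThrough (signedCubicForrelationProblem 2) _ _ _ hS hRc ?_ ?_
  · rintro _ ⟨I, hI, rfl⟩ hx
    exact ⟨I, ⟨hI.1, fun hM => hx ⟨I, ⟨hI.1, hM, hI.2⟩, rfl⟩, hI.2⟩, rfl⟩
  · rintro _ ⟨I, hI, rfl⟩ hx
    exact ⟨I, ⟨hI.1, fun hM => hx ⟨I, ⟨hI.1, hM, hI.2⟩, rfl⟩, hI.2⟩, rfl⟩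

/-- **The structure statement empties the residue.** If every cubic pair on evenly many bits with `|Φ| ≥ 3/5` has
a `⊕`-closed `V ∋ 0` with `2ⁿ ≤ |V|² (n+2)^{2c}` on whose cosets one of the two functions is affine
(`stub_structure`), then no promise instance has both-sided M-defect `> c log₂(n+2)`: the residue promise problem
of `stub_residueR` is EMPTY, hence (vacuously) in `PromiseBPP'`. -/
theorem residueR_of_structure
    (h : ∃ c : ℕ, ∀ (n : ℕ), Even n → ∀ f g : (Fin n → Bool) → Bool,
      IsDegLeFun 3 f → IsDegLeFun 3 g → (3 / 5 : ℝ) ≤ |forrelation f g| →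
      ∃ V : Finset (Fin n → Bool), zeroVec ∈ V ∧ (∀ x ∈ V, ∀ y ∈ V, bxor x y ∈ V) ∧
        2 ^ n ≤ V.card ^ 2 * (n + 2) ^ (2 * c) ∧
        ((∀ u ∈ V, ∀ v ∈ V, ∀ y, (f y ^^ f (bxor y u) ^^ f (bxor y v) ^^ f (bxor y (bxor u v))) = false) ∨
         (∀ u ∈ V, ∀ v ∈ V, ∀ y, (g y ^^ g (bxor y u) ^^ g (bxor y v) ^^ g (bxor y (bxor u v))) = false))) :
    ∃ c : ℕ,
    (⟨KForrelationInstance.encode ''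
        {I | I.IsYes ∧ ¬ (∃ i, ∃ V : Finset (Fin I.n → Bool), zeroVec ∈ V ∧
            (∀ x ∈ V, ∀ y ∈ V, bxor x y ∈ V) ∧ 2 ^ I.n ≤ V.card ^ 2 * (I.n + 2) ^ (2 * c) ∧
            ∀ u ∈ V, ∀ v ∈ V, ∀ y, ((I.C i).eval y ^^ (I.C i).eval (bxor y u) ^^ (I.C i).eval (bxor y v) ^^
              (I.C i).eval (bxor y (bxor u v))) = false) ∧
          I.k = 2 ∧ Even I.n ∧ ∀ i, IsDegLeFun 3 (I.C i).eval},
      KForrelationInstance.encode ''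
        {I | (I.IsOverB2 ∧ I.value ≤ -(3 / 5 : ℝ)) ∧ ¬ (∃ i, ∃ V : Finset (Fin I.n → Bool), zeroVec ∈ V ∧
            (∀ x ∈ V, ∀ y ∈ V, bxor x y ∈ V) ∧ 2 ^ I.n ≤ V.card ^ 2 * (I.n + 2) ^ (2 * c) ∧
            ∀ u ∈ V, ∀ v ∈ V, ∀ y, ((I.C i).eval y ^^ (I.C i).eval (bxor y u) ^^ (I.C i).eval (bxor y v) ^^
              (I.C i).eval (bxor y (bxor u v))) = false) ∧
          I.k = 2 ∧ Even I.n ∧ ∀ i, IsDegLeFun 3 (I.C i).eval}⟩ : PromiseProblem) ∈ PromiseBPP' := by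
  obtain ⟨c, hc⟩ := h
  -- on a promise instance the structure statement puts one of the two circuits on the relaxed MM side
  have hside : ∀ (I : KForrelationInstance), I.k = 2 → Even I.n → (∀ i, IsDegLeFun 3 (I.C i).eval) →
      (3 / 5 : ℝ) ≤ |I.value| →
      ∃ i, ∃ V : Finset (Fin I.n → Bool), zeroVec ∈ V ∧
        (∀ x ∈ V, ∀ y ∈ V, bxor x y ∈ V) ∧ 2 ^ I.n ≤ V.card ^ 2 * (I.n + 2) ^ (2 * c) ∧
        ∀ u ∈ V, ∀ v ∈ V, ∀ y, ((I.C i).eval y ^^ (I.C i).eval (bxor y u) ^^ (I.C i).eval (bxor y v) ^^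
          (I.C i).eval (bxor y (bxor u v))) = false := by
    intro I hk hn hdeg hΦ
    rw [KForrelationInstance.value_eq_forrelation hk] at hΦ
    obtain ⟨V, h0, hadd, hcard, hf | hg⟩ := hc I.n hn _ _ (hdeg _) (hdeg _) hΦ
    · exact ⟨_, V, h0, hadd, hcard, hf⟩
    · exact ⟨_, V, h0, hadd, hcard, hg⟩
  refine ⟨c, ⊥, bot_mem_P, 0, ?_, ?_⟩
  · rintro _ ⟨I, hI, rfl⟩
    exact (hI.2.1 (hside I hI.2.2.1 hI.2.2.2.1 hI.2.2.2.2 (le_trans hI.1.2 (le_abs_self _)))).elim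
  · rintro _ ⟨I, hI, rfl⟩
    refine (hI.2.1 (hside I hI.2.2.1 hI.2.2.2.1 hI.2.2.2.2 ?_)).elim
    have h := hI.1.2
    rw [abs_of_neg (by linarith)]
    linarith

/-- **The crux from the finder and the structure statement** (the intended discharge of the residue):
`stub_finderR ∧ stub_structure ⇒ SignedCubicForrelationInPrBPP`. -/
theorem SignedCubicForrelationInPrBPP_of_finderR_of_structure
    (hF : ∀ c : ℕ, ∃ c' : ℕ, ∃ find ∈ FP, ∃ p : Polynomial ℕ, ∀ (I : KForrelationInstance) (hk : I.k = 2),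
      Even I.n → I.IsOverB2 → (∀ i, IsDegLeFun 3 (I.C i).eval) → (3 / 5 : ℝ) ≤ |I.value| →
      (∃ V : Finset (Fin I.n → Bool), zeroVec ∈ V ∧ (∀ x ∈ V, ∀ y ∈ V, bxor x y ∈ V) ∧
        2 ^ I.n ≤ V.card ^ 2 * (I.n + 2) ^ (2 * c) ∧
        ∀ u ∈ V, ∀ v ∈ V, ∀ y, ((I.C (Fin.cast hk.symm 1)).eval y ^^
          (I.C (Fin.cast hk.symm 1)).eval (bxor y u) ^^ (I.C (Fin.cast hk.symm 1)).eval (bxor y v) ^^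
          (I.C (Fin.cast hk.symm 1)).eval (bxor y (bxor u v))) = false) →
      (2 / 3 : ℝ) ≤ uniformProb (p.eval I.encode.length)
        {y | ∃ L : List (List Bool), find (boolPair I.encode y) = encList L ∧
          I.n ≤ 2 * Module.finrank (ZMod 2) ↥(F2Elim.rowSpan I.n L) + c' * Nat.log 2 (I.n + 2) ∧
          ∀ u v : Fin I.n → Bool, (fun i => if u i then (1 : ZMod 2) else 0) ∈ F2Elim.rowSpan I.n L →
            (fun i => if v i then (1 : ZMod 2) else 0) ∈ F2Elim.rowSpan I.n L →
          ∀ y, ((I.C (Fin.cast hk.symm 1)).eval y ^^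
            (I.C (Fin.cast hk.symm 1)).eval (bxor y u) ^^ (I.C (Fin.cast hk.symm 1)).eval (bxor y v) ^^
            (I.C (Fin.cast hk.symm 1)).eval (bxor y (bxor u v))) = false})
    (hS : ∃ c : ℕ, ∀ (n : ℕ), Even n → ∀ f g : (Fin n → Bool) → Bool,
      IsDegLeFun 3 f → IsDegLeFun 3 g → (3 / 5 : ℝ) ≤ |forrelation f g| →
      ∃ V : Finset (Fin n → Bool), zeroVec ∈ V ∧ (∀ x ∈ V, ∀ y ∈ V, bxor x y ∈ V) ∧
        2 ^ n ≤ V.card ^ 2 * (n + 2) ^ (2 * c) ∧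
        ((∀ u ∈ V, ∀ v ∈ V, ∀ y, (f y ^^ f (bxor y u) ^^ f (bxor y v) ^^ f (bxor y (bxor u v))) = false) ∨
         (∀ u ∈ V, ∀ v ∈ V, ∀ y, (g y ^^ g (bxor y u) ^^ g (bxor y v) ^^ g (bxor y (bxor u v))) = false))) :
    SignedCubicForrelationInPrBPP :=
  SignedCubicForrelationInPrBPP_of_finderR_of_residueR hF (residueR_of_structure hS)

/-- **The residue is a sub-promise of the crux**: `SignedCubicForrelationInPrBPP` implies the residue statement of
`stub_residueR` for EVERY defect constant `c` (so that stub is never falser than the crux). -/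
theorem residueR_of_SignedCubicForrelationInPrBPP (h : SignedCubicForrelationInPrBPP) (c : ℕ) :
    (⟨KForrelationInstance.encode ''
        {I | I.IsYes ∧ ¬ (∃ i, ∃ V : Finset (Fin I.n → Bool), zeroVec ∈ V ∧
            (∀ x ∈ V, ∀ y ∈ V, bxor x y ∈ V) ∧ 2 ^ I.n ≤ V.card ^ 2 * (I.n + 2) ^ (2 * c) ∧
            ∀ u ∈ V, ∀ v ∈ V, ∀ y, ((I.C i).eval y ^^ (I.C i).eval (bxor y u) ^^ (I.C i).eval (bxor y v) ^^
              (I.C i).eval (bxor y (bxor u v))) = false) ∧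
          I.k = 2 ∧ Even I.n ∧ ∀ i, IsDegLeFun 3 (I.C i).eval},
      KForrelationInstance.encode ''
        {I | (I.IsOverB2 ∧ I.value ≤ -(3 / 5 : ℝ)) ∧ ¬ (∃ i, ∃ V : Finset (Fin I.n → Bool), zeroVec ∈ V ∧
            (∀ x ∈ V, ∀ y ∈ V, bxor x y ∈ V) ∧ 2 ^ I.n ≤ V.card ^ 2 * (I.n + 2) ^ (2 * c) ∧
            ∀ u ∈ V, ∀ v ∈ V, ∀ y, ((I.C i).eval y ^^ (I.C i).eval (bxor y u) ^^ (I.C i).eval (bxor y v) ^^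
              (I.C i).eval (bxor y (bxor u v))) = false) ∧
          I.k = 2 ∧ Even I.n ∧ ∀ i, IsDegLeFun 3 (I.C i).eval}⟩ : PromiseProblem) ∈ PromiseBPP' := by
  obtain ⟨L', hL', p, hyes, hno⟩ := h
  refine ⟨L', hL', p, fun x hx => hyes x ?_, fun x hx => hno x ?_⟩
  · obtain ⟨I, hI, rfl⟩ := hx
    exact ⟨I, ⟨hI.1, hI.2.2⟩, rfl⟩
  · obtain ⟨I, hI, rfl⟩ := hx
    exact ⟨I, ⟨hI.1, hI.2.2⟩, rfl⟩

end Summit.QuantumAdvantage.QuantumAdvantage.Theorems.SignedCubicForrelationInPrBPP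

end
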